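import Literature.Probability.Percolation.StripWindows
import Literature.Probability.Percolation.FineZones
import HarnessLib

/-!
# The fine block data of a strip window

Topic `Probability/Percolation`.  Support file (definitions and proofs, no named fact) for the zone
geometry of the proof of Schramm–Smirnov's Prop. 4.1 (Ann. Probab. 39 (2011), §4), per-strip form.
The coarse window of a maximal strip (`StripData.window`, `StripWindows.lean`) and its excised cores
are refined by an integer ratio `R ≥ 4` into FINE blocks (`refine`, `cOf`), giving the block data
`StripData.blockData k R : FineBlocks.BlockData` of `FineZones.lean`, and the four block-level
hypotheses of that file are discharged:

* `blockData_far_conn` — the far fine blocks (those of coarse blocks outside the filling) are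
  4-connected: the outside of the filling is (`StripData.conn_compl_F`), and coarse chains lift
  (`conn_fine_of_conn`);
* `blockData_SQ_far`, `blockData_SQ_inner` — every excised fine block is joined through excised fine
  blocks to one next to a far fine block, and to one next to an inner fine block (excised cores touch
  the outside and the strip; the middle of a shared side is inner);
* `blockData_NB_conn` — the inner fine blocks (window fine blocks with no far block among their eight
  neighbours) are 4-connected: the INSET of every window coarse block is inner and 4-connected, insets
  of adjacent window blocks are joined through the middle of the shared side, every inner block is
  two inward steps from an inset, and the window is 4-connected (`StripData.window_conn`).

## References

* O. Schramm, S. Smirnov, Ann. Probab. 39 (2011), arXiv:1101.5820, §4, proof of Prop. 4.1 (the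
  strips and the discs at the junctions; the collar of width ≪ the strip scale). [SchrammSmirnov2011]
-/

noncomputable section

open Set Relation
open scoped Classical

namespace Literature.Probability.Percolation

namespace FineBlocks

variable {R : ℤ} {z z' w : ℤ × ℤ} {Z Z' : ℤ × ℤ}

/-! ### Refinement arithmetic -/

/-- **The coarse block of a fine block** at integer ratio `R`. [folklore] -/
def cOf (R : ℤ) (z : ℤ × ℤ) : ℤ × ℤ := (z.1 / R, z.2 / R)

/-- `cOf_eq_iff` (cOf eq iff). [folklore] -/
theorem cOf_eq_iff (hR : 0 < R) : cOf R z = Z ↔ (Z.1 * R ≤ z.1 ∧ z.1 < Z.1 * R + R) ∧ (Z.2 * R ≤ z.2 ∧ z.2 < Z.2 * R + R) := by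
  rw [cOf, Prod.ext_iff, Int.ediv_eq_iff_of_pos hR, Int.ediv_eq_iff_of_pos hR]

/-- Bounds of a fine block in terms of its coarse block. [folklore] -/
theorem bounds_cOf (hR : 0 < R) (z : ℤ × ℤ) :
    ((cOf R z).1 * R ≤ z.1 ∧ z.1 < (cOf R z).1 * R + R) ∧ ((cOf R z).2 * R ≤ z.2 ∧ z.2 < (cOf R z).2 * R + R) :=
  (cOf_eq_iff hR).1 rfl

/-- The fine block of a coarse block with given offsets. [folklore] -/
theorem cOf_mk (hR : 0 < R) (Z : ℤ × ℤ) {i j : ℤ} (hi : 0 ≤ i) (hi' : i < R) (hj : 0 ≤ j) (hj' : j < R) :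
    cOf R (Z.1 * R + i, Z.2 * R + j) = Z :=
  (cOf_eq_iff hR).2 ⟨⟨by simp only; linarith, by simp only; linarith⟩, by simp only; linarith, by simp only; linarith⟩

/-- Integer division moves by at most one along a unit step. [folklore] -/
theorem ediv_step (hR : 0 < R) (x : ℤ) : x / R ≤ (x + 1) / R ∧ (x + 1) / R ≤ x / R + 1 := by
  refine ⟨Int.ediv_le_ediv hR (by linarith), ?_⟩
  have h := Int.add_mul_ediv_right x 1 hR.ne'
  rw [one_mul] at h
  rw [← h]
  exact Int.ediv_le_ediv hR (by linarith)

/-- `ediv_near` (ediv near). [folklore] -/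
theorem ediv_near (hR : 0 < R) {x y : ℤ} (h : |x - y| ≤ 1) : |x / R - y / R| ≤ 1 := by
  rw [abs_le] at h ⊢
  rcases (show y = x - 1 ∨ y = x ∨ y = x + 1 by omega) with rfl | rfl | rfl
  · have := ediv_step hR (x - 1); rw [sub_add_cancel] at this; omega
  · simp
  · have := ediv_step hR x; omega

/-- `ediv_oneStep` (ediv oneStep). [folklore] -/
theorem ediv_oneStep (hR : 0 < R) {x y : ℤ} (h : |x - y| = 1) : x / R = y / R ∨ |x / R - y / R| = 1 := by
  have h1 := ediv_near hR h.le
  rw [abs_le] at h1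
  by_cases he : x / R = y / R
  · exact Or.inl he
  · right; rw [abs_eq (by norm_num : (0 : ℤ) ≤ 1)]; omega

/-- **Adjacent fine blocks lie in equal or adjacent coarse blocks.** [folklore] -/
theorem cOf_oneStep (hR : 0 < R) (h : OneStep z z') : cOf R z = cOf R z' ∨ OneStep (cOf R z) (cOf R z') := by
  rcases h with ⟨h1, h2⟩ | ⟨h1, h2⟩
  · have e1 : (cOf R z).1 = (cOf R z').1 := by simp [cOf, h1]
    rcases ediv_oneStep hR h2 with h | h
    · exact Or.inl (Prod.ext e1 h)
    · exact Or.inr (Or.inl ⟨e1, h⟩)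
  · have e2 : (cOf R z).2 = (cOf R z').2 := by simp [cOf, h1]
    rcases ediv_oneStep hR h2 with h | h
    · exact Or.inl (Prod.ext h e2)
    · exact Or.inr (Or.inr ⟨e2, h⟩)

/-- **Near fine blocks lie in near coarse blocks.** [folklore] -/
theorem cOf_near (hR : 0 < R) (h : Near z z') : Near (cOf R z) (cOf R z') :=
  ⟨ediv_near hR h.1, ediv_near hR h.2⟩

/-- **The fine blocks of one coarse block are 4-connected inside it.** [folklore] -/
theorem conn_cOf (hR : 0 < R) (hz : cOf R z = Z) (hz' : cOf R z' = Z) : Conn {w | cOf R w = Z} z z' := by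
  obtain ⟨⟨a1, a2⟩, a3, a4⟩ := (cOf_eq_iff hR).1 hz
  obtain ⟨⟨b1, b2⟩, b3, b4⟩ := (cOf_eq_iff hR).1 hz'
  -- horizontal to the column of `z'`, then vertical
  have horiz : Conn {w | cOf R w = Z} z (z'.1, z.2) := by
    rcases le_total z.1 z'.1 with hle | hle
    · have := conn_right (S := {w | cOf R w = Z}) z (z'.1 - z.1).toNat fun i hi =>
        (cOf_eq_iff hR).2 ⟨⟨by simp only; omega, by simp only; omega⟩, a3, a4⟩
      rwa [show z.1 + ((z'.1 - z.1).toNat : ℕ) = z'.1 by omega] at this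
    · have := conn_left (S := {w | cOf R w = Z}) z (z.1 - z'.1).toNat fun i hi =>
        (cOf_eq_iff hR).2 ⟨⟨by simp only; omega, by simp only; omega⟩, a3, a4⟩
      rwa [show z.1 - ((z.1 - z'.1).toNat : ℕ) = z'.1 by omega] at this
  have vert : Conn {w | cOf R w = Z} (z'.1, z.2) z' := by
    rcases le_total z.2 z'.2 with hle | hle
    · have := conn_up (S := {w | cOf R w = Z}) (z'.1, z.2) (z'.2 - z.2).toNat fun i hi =>
        (cOf_eq_iff hR).2 ⟨⟨b1, b2⟩, by simp only; omega, by simp only; omega⟩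
      rwa [show ((z'.1, z.2) : ℤ × ℤ).2 + ((z'.2 - z.2).toNat : ℕ) = z'.2 by simp only; omega] at this
    · have := conn_down (S := {w | cOf R w = Z}) (z'.1, z.2) (z.2 - z'.2).toNat fun i hi =>
        (cOf_eq_iff hR).2 ⟨⟨b1, b2⟩, by simp only; omega, by simp only; omega⟩
      rwa [show ((z'.1, z.2) : ℤ × ℤ).2 - ((z.2 - z'.2).toNat : ℕ) = z'.2 by simp only; omega] at this
  exact horiz.trans vert

/-- **Adjacent coarse blocks carry adjacent fine blocks.** [folklore] -/
theorem exists_fine_oneStep (hR : 0 < R) (h : OneStep Z Z') :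
    ∃ z z', cOf R z = Z ∧ cOf R z' = Z' ∧ OneStep z z' := by
  have hR1 : (0 : ℤ) ≤ R - 1 := by omega
  rcases h with ⟨h1, h2⟩ | ⟨h1, h2⟩
  · rcases (show Z'.2 = Z.2 + 1 ∨ Z'.2 = Z.2 - 1 by
        rcases abs_eq (by norm_num : (0:ℤ) ≤ 1) |>.1 h2 with h | h <;> omega) with h3 | h3
    · refine ⟨(Z.1 * R + 0, Z.2 * R + (R - 1)), (Z'.1 * R + 0, Z'.2 * R + 0), cOf_mk hR Z le_rfl hR hR1 (by omega),
        cOf_mk hR Z' le_rfl hR le_rfl hR, Or.inl ⟨by simp [h1], ?_⟩⟩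
      simp only [h3]; rw [abs_eq (by norm_num : (0:ℤ) ≤ 1)]; right; ring
    · refine ⟨(Z.1 * R + 0, Z.2 * R + 0), (Z'.1 * R + 0, Z'.2 * R + (R - 1)), cOf_mk hR Z le_rfl hR le_rfl hR,
        cOf_mk hR Z' le_rfl hR hR1 (by omega), Or.inl ⟨by simp [h1], ?_⟩⟩
      simp only [h3]; rw [abs_eq (by norm_num : (0:ℤ) ≤ 1)]; left; ring
  · rcases (show Z'.1 = Z.1 + 1 ∨ Z'.1 = Z.1 - 1 by
        rcases abs_eq (by norm_num : (0:ℤ) ≤ 1) |>.1 h2 with h | h <;> omega) with h3 | h3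
    · refine ⟨(Z.1 * R + (R - 1), Z.2 * R + 0), (Z'.1 * R + 0, Z'.2 * R + 0), cOf_mk hR Z hR1 (by omega) le_rfl hR,
        cOf_mk hR Z' le_rfl hR le_rfl hR, Or.inr ⟨by simp [h1], ?_⟩⟩
      simp only [h3]; rw [abs_eq (by norm_num : (0:ℤ) ≤ 1)]; right; ring
    · refine ⟨(Z.1 * R + 0, Z.2 * R + 0), (Z'.1 * R + (R - 1), Z'.2 * R + 0), cOf_mk hR Z le_rfl hR le_rfl hR,
        cOf_mk hR Z' hR1 (by omega) le_rfl hR, Or.inr ⟨by simp [h1], ?_⟩⟩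
      simp only [h3]; rw [abs_eq (by norm_num : (0:ℤ) ≤ 1)]; left; ring

/-- **Coarse chains lift to fine chains.** [folklore] -/
theorem conn_fine_of_conn (hR : 0 < R) {A : Set (ℤ × ℤ)} (h : Conn A Z Z') (hz : cOf R z = Z) (hz' : cOf R z' = Z')
    (hZ : Z ∈ A) : Conn {w | cOf R w ∈ A} z z' := by
  have inside : ∀ {W : ℤ × ℤ} {p q : ℤ × ℤ}, W ∈ A → cOf R p = W → cOf R q = W → Conn {w | cOf R w ∈ A} p q := by
    intro W p q hW hp hq
    exact (conn_cOf hR hp hq).mono fun w (hw : cOf R w = W) => show cOf R w ∈ A from hw ▸ hW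
  have key : ∀ W, Conn A Z W → W ∈ A → ∀ q, cOf R q = W → Conn {w | cOf R w ∈ A} z q := by
    intro W hW
    unfold Conn at hW
    induction hW with
    | refl => intro hZA q hq; exact inside hZA hz hq
    | @tail V W _ hVW ih =>
      intro hWA q hq
      obtain ⟨hVA, -, hstep⟩ := hVW
      obtain ⟨p, p', hp, hp', hpp'⟩ := exists_fine_oneStep hR hstep
      refine ((ih hVA p hp).trans (conn_single (show cOf R p ∈ A by rw [hp]; exact hVA)
        (show cOf R p' ∈ A by rw [hp']; exact hWA) hpp')).trans (inside hWA hp' hq)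
  exact key Z' h (h.mem hZ) z' hz'

/-! ### Refinement of a finite set -/

/-- **The fine blocks of a finite set of coarse blocks.** [folklore] -/
def refine (R : ℤ) (A : Finset (ℤ × ℤ)) : Finset (ℤ × ℤ) :=
  A.biUnion fun Z => Finset.Ico (Z.1 * R) (Z.1 * R + R) ×ˢ Finset.Ico (Z.2 * R) (Z.2 * R + R)

/-- `mem_refine_iff` (mem refine iff). [folklore] -/
theorem mem_refine_iff (hR : 0 < R) {A : Finset (ℤ × ℤ)} : z ∈ refine R A ↔ cOf R z ∈ A := by
  simp only [refine, Finset.mem_biUnion, Finset.mem_product, Finset.mem_Ico]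
  constructor
  · rintro ⟨Z, hZ, ⟨h1, h2⟩, h3, h4⟩
    rwa [(cOf_eq_iff hR).2 ⟨⟨h1, h2⟩, h3, h4⟩]
  · intro h
    exact ⟨cOf R z, h, (bounds_cOf hR z).1, (bounds_cOf hR z).2⟩

/-! ### Inner fine blocks: insets and inward steps -/

/-- **Inset fine blocks** of the coarse block `Z`: off its boundary layer. [folklore] -/
def Inset (R : ℤ) (Z z : ℤ × ℤ) : Prop :=
  Z.1 * R + 1 ≤ z.1 ∧ z.1 ≤ Z.1 * R + R - 2 ∧ Z.2 * R + 1 ≤ z.2 ∧ z.2 ≤ Z.2 * R + R - 2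

/-- `Inset.cOf_eq` (Inset cOf eq). [folklore] -/
theorem Inset.cOf_eq (hR : 0 < R) (h : Inset R Z z) : cOf R z = Z :=
  (cOf_eq_iff hR).2 ⟨⟨by linarith [h.1], by linarith [h.2.1]⟩, by linarith [h.2.2.1], by linarith [h.2.2.2]⟩

/-- The eight neighbours of an inset block lie in the same coarse block. [folklore] -/
theorem Inset.cOf_eq_of_near (hR : 0 < R) (h : Inset R Z z) (hw : Near z w) : cOf R w = Z := by
  obtain ⟨h1, h2, h3, h4⟩ := h
  obtain ⟨n1, n2⟩ := hw
  rw [abs_le] at n1 n2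
  exact (cOf_eq_iff hR).2 ⟨⟨by linarith, by linarith⟩, by linarith, by linarith⟩

/-- The canonical inset block. [folklore] -/
theorem inset_canonical (hR : 3 ≤ R) (Z : ℤ × ℤ) : Inset R Z (Z.1 * R + 1, Z.2 * R + 1) :=
  ⟨le_rfl, by simp only; linarith, le_rfl, by simp only; linarith⟩

end FineBlocks

namespace FineBlocks.StripData

open FineBlocks

variable (𝔖 : StripData) {R : ℤ} {k : Fin 𝔖.n} {z z' w : ℤ × ℤ} {Z Z' : ℤ × ℤ}

/-- The excised coarse blocks of strip `k`. [folklore] -/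
def sqBlocks (k : Fin 𝔖.n) : Finset (ℤ × ℤ) := (𝔖.sqC k).biUnion 𝔖.C

variable {𝔖}

/-- `mem_sqBlocks_iff` (mem sqBlocks iff). [folklore] -/
theorem mem_sqBlocks_iff : Z ∈ 𝔖.sqBlocks k ↔ ∃ c ∈ 𝔖.sqC k, Z ∈ 𝔖.C c := by simp [sqBlocks]

/-- `window_inter_sqBlocks` (window inter sqBlocks). [folklore] -/
theorem not_mem_sqBlocks_of_mem_window (hZ : Z ∈ 𝔖.window k) : Z ∉ 𝔖.sqBlocks k := fun h => by
  obtain ⟨c, hc, hZc⟩ := mem_sqBlocks_iff.1 h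
  exact (mem_window_iff.1 hZ).2 c hc hZc

/-- `mem_F_iff_window_or_sqBlocks` (mem F iff window or sqBlocks). [folklore] -/
theorem mem_F_iff_window_or_sqBlocks : Z ∈ 𝔖.F k ↔ Z ∈ 𝔖.window k ∨ Z ∈ 𝔖.sqBlocks k := by
  rw [mem_F_iff', mem_sqBlocks_iff]

variable (𝔖) in
/-- **The fine block data of strip `k`** at refinement ratio `R`: the fine blocks of the window and of
the excised cores. [cite: SchrammSmirnov2011, §4, proof of Prop. 4.1 (the strip K_j and the discs)] -/
def blockData (k : Fin 𝔖.n) (hR : 0 < R) : BlockData where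
  TT := refine R (𝔖.window k)
  SQB := refine R (𝔖.sqBlocks k)
  disj := Finset.disjoint_left.2 fun _ hz hz' =>
    not_mem_sqBlocks_of_mem_window ((mem_refine_iff hR).1 hz) ((mem_refine_iff hR).1 hz')

variable {hR : 0 < R}

/-- `mem_TT_iff` (mem TT iff). [folklore] -/
theorem mem_TT_iff : z ∈ (𝔖.blockData k hR).TT ↔ cOf R z ∈ 𝔖.window k := mem_refine_iff hR

/-- `mem_SQB_iff` (mem SQB iff). [folklore] -/
theorem mem_SQB_iff : z ∈ (𝔖.blockData k hR).SQB ↔ cOf R z ∈ 𝔖.sqBlocks k := mem_refine_iff hR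

/-- **Far fine blocks are the fine blocks of the coarse blocks outside the filling.** [folklore] -/
theorem farB_iff : (𝔖.blockData k hR).farB z ↔ cOf R z ∉ 𝔖.F k := by
  rw [BlockData.farB, mem_TT_iff, mem_SQB_iff, mem_F_iff_window_or_sqBlocks, not_or]

/-- **The far fine blocks are 4-connected.** [folklore] -/
theorem blockData_far_conn : ∀ a b, (𝔖.blockData k hR).farB a → (𝔖.blockData k hR).farB b →
    ReflTransGen (fun x y => (𝔖.blockData k hR).farB x ∧ (𝔖.blockData k hR).farB y ∧ OneStep x y) a b := by
  intro a b ha hb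
  rw [farB_iff] at ha hb
  have h := conn_fine_of_conn hR (A := (↑(𝔖.F k))ᶜ) (conn_compl_F ha hb) rfl rfl ha
  refine reflTransGen_of_imp (fun x y ⟨hx, hy, hxy⟩ => ⟨farB_iff.2 hx, farB_iff.2 hy, hxy⟩) h

/-- **Every excised fine block is joined through excised fine blocks to one next to a far fine block.**
[folklore] -/
theorem blockData_SQ_far : ∀ q ∈ (𝔖.blockData k hR).SQB, ∃ q' z,
    ReflTransGen (fun x y => x ∈ (𝔖.blockData k hR).SQB ∧ y ∈ (𝔖.blockData k hR).SQB ∧ OneStep x y) q q' ∧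
      OneStep q' z ∧ (𝔖.blockData k hR).farB z := by
  intro q hq
  obtain ⟨c, hc, hqc⟩ := mem_sqBlocks_iff.1 (mem_SQB_iff.1 hq)
  obtain ⟨X, hX, Y, hXY, hY⟩ := exists_oneStep_not_mem_F hc
  obtain ⟨p, p', hp, hp', hpp'⟩ := exists_fine_oneStep hR hXY
  -- inside the core from the block of `q` to `X`, then inside `X` to `p`
  have hC : ∀ W ∈ 𝔖.C c, W ∈ 𝔖.sqBlocks k := fun W hW => mem_sqBlocks_iff.2 ⟨c, hc, hW⟩
  have h1 := conn_fine_of_conn hR (A := (↑(𝔖.C c) : Set (ℤ × ℤ))) (𝔖.C_conn c _ hqc X hX) rfl hp hqc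
  refine ⟨p, p', reflTransGen_of_imp (fun x y ⟨hx, hy, hxy⟩ => ⟨mem_SQB_iff.2 (hC _ hx), mem_SQB_iff.2 (hC _ hy), hxy⟩) h1,
    hpp', farB_iff.2 (by rw [hp']; exact hY)⟩

/-! ### Inner fine blocks -/

section Inner

/-- A window fine block all of whose eight neighbours lie in blocks of the filling is inner. [folklore] -/
theorem mem_NB_of_forall_near (hz : cOf R z ∈ 𝔖.window k) (h : ∀ w, Near z w → cOf R w ∈ 𝔖.F k) :
    z ∈ (𝔖.blockData k hR).NB := by
  refine (𝔖.blockData k hR).mem_NB_iff.2 ⟨mem_TT_iff.2 hz, ?_⟩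
  rintro ⟨w, hw, hwfar⟩
  exact (farB_iff.1 hwfar) (h w hw)

/-- Inner blocks are window blocks. [folklore] -/
theorem cOf_mem_window_of_mem_NB (hz : z ∈ (𝔖.blockData k hR).NB) : cOf R z ∈ 𝔖.window k :=
  mem_TT_iff.1 ((𝔖.blockData k hR).mem_NB_iff.1 hz).1

/-- Neighbours of inner blocks lie in blocks of the filling. [folklore] -/
theorem cOf_mem_F_of_near_of_mem_NB (hz : z ∈ (𝔖.blockData k hR).NB) (hw : Near z w) : cOf R w ∈ 𝔖.F k := by
  by_contra h
  exact ((𝔖.blockData k hR).mem_NB_iff.1 hz).2 ⟨w, hw, farB_iff.2 h⟩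

/-- **Inset blocks of window coarse blocks are inner.** [folklore] -/
theorem mem_NB_of_inset (hZ : Z ∈ 𝔖.window k) (h : Inset R Z z) : z ∈ (𝔖.blockData k hR).NB := by
  refine mem_NB_of_forall_near (by rw [h.cOf_eq hR]; exact hZ) fun w hw => ?_
  rw [h.cOf_eq_of_near hR hw]
  exact (mem_F_iff').2 (Or.inl hZ)

/-- **Inward steps stay inner**: stepping from an inner block by a unit vector `e` such that `z + e`
and `z + 2e` are still in the coarse block of `z`. [folklore] -/
theorem mem_NB_step (hz : z ∈ (𝔖.blockData k hR).NB) (e : ℤ × ℤ) (he : |e.1| + |e.2| = 1)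
    (h1 : cOf R (z.1 + e.1, z.2 + e.2) = cOf R z) (h2 : cOf R (z.1 + 2 * e.1, z.2 + 2 * e.2) = cOf R z) :
    (z.1 + e.1, z.2 + e.2) ∈ (𝔖.blockData k hR).NB := by
  refine mem_NB_of_forall_near (by rw [h1]; exact cOf_mem_window_of_mem_NB hz) fun w hw => ?_
  by_cases hzw : Near z w
  · exact cOf_mem_F_of_near_of_mem_NB hz hzw
  · -- `w` is two steps from `z` along `e`: compare with the block one step back
    obtain ⟨n1, n2⟩ := hw
    rw [abs_le] at n1 n2
    simp only at n1 n2
    have habs : |e.1| ≤ 1 ∧ |e.2| ≤ 1 := ⟨by linarith [abs_nonneg e.2], by linarith [abs_nonneg e.1]⟩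
    rw [abs_le, abs_le] at habs
    have hnz : ¬ (|z.1 - w.1| ≤ 1 ∧ |z.2 - w.2| ≤ 1) := hzw
    rw [abs_le, abs_le] at hnz
    -- the offset of `w` from `z` is `2e + d⊥`
    have key : (e.1 ≠ 0 ∧ w.1 = z.1 + 2 * e.1 ∧ |w.2 - z.2| ≤ 1) ∨ (e.2 ≠ 0 ∧ w.2 = z.2 + 2 * e.2 ∧ |w.1 - z.1| ≤ 1) := by
      rcases (show (e.1 = 1 ∨ e.1 = -1) ∧ e.2 = 0 ∨ e.1 = 0 ∧ (e.2 = 1 ∨ e.2 = -1) by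
          rcases le_or_gt 0 e.1 with h | h <;> rcases le_or_gt 0 e.2 with h' | h' <;>
            simp only [abs_of_nonneg, abs_of_neg, h, h'] at he <;> omega) with ⟨h1', h2'⟩ | ⟨h1', h2'⟩
      · left; refine ⟨by omega, by omega, ?_⟩; rw [abs_le]; omega
      · right; refine ⟨by omega, by omega, ?_⟩; rw [abs_le]; omega
    rcases key with ⟨he1, hw1, hw2⟩ | ⟨he2, hw2, hw1⟩
    · -- compare with `w₀ := (z.1 + e.1, w.2)`, a neighbour of `z`
      have hw₀ : Near z (z.1 + e.1, w.2) := ⟨by rw [abs_le]; simp only; omega, by rw [abs_le] at hw2 ⊢; simp only; omega⟩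
      have hF := cOf_mem_F_of_near_of_mem_NB hz hw₀
      have e1 : (cOf R w).1 = (cOf R (z.1 + e.1, w.2)).1 := by
        have a := congrArg Prod.fst h1
        have b := congrArg Prod.fst h2
        simp only [cOf] at a b ⊢
        rw [hw1, b, ← a]
      have e2 : (cOf R w).2 = (cOf R (z.1 + e.1, w.2)).2 := by simp [cOf]
      rwa [show cOf R w = cOf R (z.1 + e.1, w.2) from Prod.ext e1 e2]
    · have hw₀ : Near z (w.1, z.2 + e.2) := ⟨by rw [abs_le] at hw1 ⊢; simp only; omega, by rw [abs_le]; simp only; omega⟩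
      have hF := cOf_mem_F_of_near_of_mem_NB hz hw₀
      have e2 : (cOf R w).2 = (cOf R (w.1, z.2 + e.2)).2 := by
        have a := congrArg Prod.snd h1
        have b := congrArg Prod.snd h2
        simp only [cOf] at a b ⊢
        rw [hw2, b, ← a]
      have e1 : (cOf R w).1 = (cOf R (w.1, z.2 + e.2)).1 := by simp [cOf]
      rwa [show cOf R w = cOf R (w.1, z.2 + e.2) from Prod.ext e1 e2]

/-- **The inset of a window coarse block is 4-connected through inner blocks.** [folklore] -/
theorem conn_inset (hZ : Z ∈ 𝔖.window k) (hz : Inset R Z z) (hz' : Inset R Z z') :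
    Conn ↑((𝔖.blockData k hR).NB) z z' := by
  obtain ⟨a1, a2, a3, a4⟩ := hz
  obtain ⟨b1, b2, b3, b4⟩ := hz'
  have nb : ∀ {w : ℤ × ℤ}, Inset R Z w → w ∈ (↑((𝔖.blockData k hR).NB) : Set (ℤ × ℤ)) :=
    fun hw => mem_NB_of_inset hZ hw
  have horiz : Conn ↑((𝔖.blockData k hR).NB) z (z'.1, z.2) := by
    rcases le_total z.1 z'.1 with hle | hle
    · have := conn_right (S := ↑((𝔖.blockData k hR).NB)) z (z'.1 - z.1).toNat fun i hi =>
        nb ⟨by simp only; omega, by simp only; omega, a3, a4⟩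
      rwa [show z.1 + ((z'.1 - z.1).toNat : ℕ) = z'.1 by omega] at this
    · have := conn_left (S := ↑((𝔖.blockData k hR).NB)) z (z.1 - z'.1).toNat fun i hi =>
        nb ⟨by simp only; omega, by simp only; omega, a3, a4⟩
      rwa [show z.1 - ((z.1 - z'.1).toNat : ℕ) = z'.1 by omega] at this
  have vert : Conn ↑((𝔖.blockData k hR).NB) (z'.1, z.2) z' := by
    rcases le_total z.2 z'.2 with hle | hle
    · have := conn_up (S := ↑((𝔖.blockData k hR).NB)) (z'.1, z.2) (z'.2 - z.2).toNat fun i hi =>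
        nb ⟨b1, b2, by simp only; omega, by simp only; omega⟩
      rwa [show ((z'.1, z.2) : ℤ × ℤ).2 + ((z'.2 - z.2).toNat : ℕ) = z'.2 by simp only; omega] at this
    · have := conn_down (S := ↑((𝔖.blockData k hR).NB)) (z'.1, z.2) (z.2 - z'.2).toNat fun i hi =>
        nb ⟨b1, b2, by simp only; omega, by simp only; omega⟩
      rwa [show ((z'.1, z.2) : ℤ × ℤ).2 - ((z.2 - z'.2).toNat : ℕ) = z'.2 by simp only; omega] at this
  exact horiz.trans vert

variable (hR4 : 4 ≤ R)
include hR4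

/-- **Every inner block is joined through inner blocks to an inset block of its coarse block** (two
inward steps). [folklore] -/
theorem exists_inset_conn_of_mem_NB (hz : z ∈ (𝔖.blockData k hR).NB) :
    ∃ z₀, Inset R (cOf R z) z₀ ∧ Conn ↑((𝔖.blockData k hR).NB) z z₀ := by
  have hR : 0 < R := by omega
  obtain ⟨⟨a1, a2⟩, a3, a4⟩ := bounds_cOf hR z
  -- first coordinate
  obtain ⟨z₁, hz₁NB, hz₁c, hz₁1, hz₁2, hz₁row, hzz₁⟩ : ∃ z₁, z₁ ∈ (𝔖.blockData k hR).NB ∧ cOf R z₁ = cOf R z ∧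
      (cOf R z).1 * R + 1 ≤ z₁.1 ∧ z₁.1 ≤ (cOf R z).1 * R + R - 2 ∧ z₁.2 = z.2 ∧ Conn ↑((𝔖.blockData k hR).NB) z z₁ := by
    by_cases hl : z.1 = (cOf R z).1 * R
    · have h1 : cOf R (z.1 + 1, z.2 + 0) = cOf R z := (cOf_eq_iff hR).2 ⟨⟨by simp only; omega, by simp only; omega⟩, by simp only; omega, by simp only; omega⟩
      have h2 : cOf R (z.1 + 2 * 1, z.2 + 2 * 0) = cOf R z := (cOf_eq_iff hR).2 ⟨⟨by simp only; omega, by simp only; omega⟩, by simp only; omega, by simp only; omega⟩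
      have hNB := mem_NB_step hz (1, 0) (by simp) h1 h2
      refine ⟨(z.1 + 1, z.2 + 0), hNB, h1, by simp only; omega, by simp only; omega, by simp, ?_⟩
      exact conn_single hz hNB (Or.inr ⟨by simp, by simp⟩)
    by_cases hr : z.1 = (cOf R z).1 * R + R - 1
    · have h1 : cOf R (z.1 + (-1), z.2 + 0) = cOf R z := (cOf_eq_iff hR).2 ⟨⟨by simp only; omega, by simp only; omega⟩, by simp only; omega, by simp only; omega⟩
      have h2 : cOf R (z.1 + 2 * (-1), z.2 + 2 * 0) = cOf R z := (cOf_eq_iff hR).2 ⟨⟨by simp only; omega, by simp only; omega⟩, by simp only; omega, by simp only; omega⟩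
      have hNB := mem_NB_step hz (-1, 0) (by simp) h1 h2
      refine ⟨(z.1 + (-1), z.2 + 0), hNB, h1, by simp only; omega, by simp only; omega, by simp, ?_⟩
      exact conn_single hz hNB (Or.inr ⟨by simp, by simp⟩)
    · exact ⟨z, hz, rfl, by omega, by omega, rfl, conn_refl⟩
  -- second coordinate, from `z₁`
  obtain ⟨⟨b1, b2⟩, b3, b4⟩ := (cOf_eq_iff hR).1 hz₁c
  obtain ⟨z₂, hz₂NB, hins, hz₁z₂⟩ : ∃ z₂, z₂ ∈ (𝔖.blockData k hR).NB ∧ Inset R (cOf R z) z₂ ∧ Conn ↑((𝔖.blockData k hR).NB) z₁ z₂ := by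
    by_cases hl : z₁.2 = (cOf R z).2 * R
    · have h1 : cOf R (z₁.1 + 0, z₁.2 + 1) = cOf R z₁ := by
        rw [hz₁c]; exact (cOf_eq_iff hR).2 ⟨⟨by simp only; omega, by simp only; omega⟩, by simp only; omega, by simp only; omega⟩
      have h2 : cOf R (z₁.1 + 2 * 0, z₁.2 + 2 * 1) = cOf R z₁ := by
        rw [hz₁c]; exact (cOf_eq_iff hR).2 ⟨⟨by simp only; omega, by simp only; omega⟩, by simp only; omega, by simp only; omega⟩
      have hNB := mem_NB_step hz₁NB (0, 1) (by simp) h1 h2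
      refine ⟨(z₁.1 + 0, z₁.2 + 1), hNB, ⟨by simp only; omega, by simp only; omega, by simp only; omega, by simp only; omega⟩, ?_⟩
      exact conn_single hz₁NB hNB (Or.inl ⟨by simp, by simp⟩)
    by_cases hr : z₁.2 = (cOf R z).2 * R + R - 1
    · have h1 : cOf R (z₁.1 + 0, z₁.2 + (-1)) = cOf R z₁ := by
        rw [hz₁c]; exact (cOf_eq_iff hR).2 ⟨⟨by simp only; omega, by simp only; omega⟩, by simp only; omega, by simp only; omega⟩
      have h2 : cOf R (z₁.1 + 2 * 0, z₁.2 + 2 * (-1)) = cOf R z₁ := by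
        rw [hz₁c]; exact (cOf_eq_iff hR).2 ⟨⟨by simp only; omega, by simp only; omega⟩, by simp only; omega, by simp only; omega⟩
      have hNB := mem_NB_step hz₁NB (0, -1) (by simp) h1 h2
      refine ⟨(z₁.1 + 0, z₁.2 + (-1)), hNB, ⟨by simp only; omega, by simp only; omega, by simp only; omega, by simp only; omega⟩, ?_⟩
      exact conn_single hz₁NB hNB (Or.inl ⟨by simp, by simp⟩)
    · exact ⟨z₁, hz₁NB, ⟨hz₁1, hz₁2, by omega, by omega⟩, conn_refl⟩
  exact ⟨z₂, hins, hzz₁.trans hz₁z₂⟩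

/-- **Insets of 4-adjacent window coarse blocks are joined through inner blocks** (across the middle
of the shared side). [folklore] -/
theorem conn_insets_of_oneStep (hZ : Z ∈ 𝔖.window k) (hZ' : Z' ∈ 𝔖.window k) (h : OneStep Z Z') :
    ∃ z z', Inset R Z z ∧ Inset R Z' z' ∧ Conn ↑((𝔖.blockData k hR).NB) z z' := by
  have hR : 0 < R := by omega
  have hFZ : Z ∈ 𝔖.F k := (mem_F_iff').2 (Or.inl hZ)
  have hFZ' : Z' ∈ 𝔖.F k := (mem_F_iff').2 (Or.inl hZ')
  -- the two middle boundary blocks are inner: their neighbours lie in `Z` or `Z'`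
  rcases h with ⟨h1, h2⟩ | ⟨h1, h2⟩
  · -- vertical adjacency; reduce to `Z'` above or below
    wlog hup : Z'.2 = Z.2 + 1 generalizing Z Z'
    · have hdown : Z'.2 = Z.2 - 1 := by
        rcases abs_eq (by norm_num : (0:ℤ) ≤ 1) |>.1 h2 with h | h <;> omega
      obtain ⟨z', z, hz', hz, hc⟩ := this hZ' hZ hFZ' hFZ h1.symm (by rw [abs_sub_comm]; exact h2) (by omega)
      exact ⟨z, z', hz, hz', hc.symm⟩
    -- `p` top middle of `Z`, `q` bottom middle of `Z'`
    have hZ'R : Z'.2 * R = Z.2 * R + R := by rw [hup]; ring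
    set p : ℤ × ℤ := (Z.1 * R + 2, Z.2 * R + R - 1) with hp
    set q : ℤ × ℤ := (Z.1 * R + 2, Z'.2 * R) with hq
    have near_pq : ∀ w, (Near p w ∨ Near q w) → cOf R w = Z ∨ cOf R w = Z' := by
      intro w hw
      have hw' : |Z.1 * R + 2 - w.1| ≤ 1 ∧ Z.2 * R + R - 2 ≤ w.2 ∧ w.2 ≤ Z.2 * R + R + 1 := by
        rcases hw with ⟨n1, n2⟩ | ⟨n1, n2⟩ <;> simp only [hp, hq] at n1 n2 <;> rw [abs_le] at n2 <;>
          exact ⟨n1, by omega, by omega⟩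
      obtain ⟨n1, n2, n3⟩ := hw'
      rw [abs_le] at n1
      by_cases hw2 : w.2 < Z.2 * R + R
      · left; exact (cOf_eq_iff hR).2 ⟨⟨by linarith, by linarith⟩, by linarith, hw2⟩
      · right; exact (cOf_eq_iff hR).2 ⟨⟨by rw [← h1]; linarith, by rw [← h1]; linarith⟩, by linarith, by linarith⟩
    have memF : ∀ w, (Near p w ∨ Near q w) → cOf R w ∈ 𝔖.F k := fun w hw => by
      rcases near_pq w hw with h | h <;> rw [h]; exacts [hFZ, hFZ']
    have hpc : cOf R p = Z := (cOf_eq_iff hR).2 ⟨⟨by simp only [hp]; linarith, by simp only [hp]; linarith⟩, by simp only [hp]; linarith, by simp only [hp]; linarith⟩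
    have hqc : cOf R q = Z' := (cOf_eq_iff hR).2 ⟨⟨by simp only [hq, ← h1]; linarith, by simp only [hq, ← h1]; linarith⟩, by simp only [hq]; linarith, by simp only [hq]; linarith⟩
    have hpNB : p ∈ (𝔖.blockData k hR).NB := mem_NB_of_forall_near (by rw [hpc]; exact hZ) fun w hw => memF w (Or.inl hw)
    have hqNB : q ∈ (𝔖.blockData k hR).NB := mem_NB_of_forall_near (by rw [hqc]; exact hZ') fun w hw => memF w (Or.inr hw)
    -- inset neighbours
    set p₀ : ℤ × ℤ := (Z.1 * R + 2, Z.2 * R + R - 2) with hp₀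
    set q₀ : ℤ × ℤ := (Z.1 * R + 2, Z'.2 * R + 1) with hq₀
    have hp₀ins : Inset R Z p₀ := ⟨by simp only [hp₀]; linarith, by simp only [hp₀]; linarith, by simp only [hp₀]; linarith, by simp only [hp₀]; linarith⟩
    have hq₀ins : Inset R Z' q₀ := ⟨by simp only [hq₀, ← h1]; linarith, by simp only [hq₀, ← h1]; linarith, by simp only [hq₀]; linarith, by simp only [hq₀]; linarith⟩
    refine ⟨p₀, q₀, hp₀ins, hq₀ins, ?_⟩
    refine ((conn_single (mem_NB_of_inset hZ hp₀ins) hpNB (Or.inl ⟨rfl, ?_⟩)).trans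
      (conn_single hpNB hqNB (Or.inl ⟨rfl, ?_⟩))).trans (conn_single hqNB (mem_NB_of_inset hZ' hq₀ins) (Or.inl ⟨rfl, ?_⟩))
    · simp only [hp₀, hp]; rw [abs_eq (by norm_num : (0:ℤ) ≤ 1)]; right; ring
    · simp only [hp, hq, hup]; rw [abs_eq (by norm_num : (0:ℤ) ≤ 1)]; right; ring
    · simp only [hq, hq₀]; rw [abs_eq (by norm_num : (0:ℤ) ≤ 1)]; right; ring
  · -- horizontal adjacency; reduce to `Z'` right of `Z`
    wlog hright : Z'.1 = Z.1 + 1 generalizing Z Z'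
    · have hleft : Z'.1 = Z.1 - 1 := by
        rcases abs_eq (by norm_num : (0:ℤ) ≤ 1) |>.1 h2 with h | h <;> omega
      obtain ⟨z', z, hz', hz, hc⟩ := this hZ' hZ hFZ' hFZ h1.symm (by rw [abs_sub_comm]; exact h2) (by omega)
      exact ⟨z, z', hz, hz', hc.symm⟩
    have hZ'R : Z'.1 * R = Z.1 * R + R := by rw [hright]; ring
    set p : ℤ × ℤ := (Z.1 * R + R - 1, Z.2 * R + 2) with hp
    set q : ℤ × ℤ := (Z'.1 * R, Z.2 * R + 2) with hq
    have near_pq : ∀ w, (Near p w ∨ Near q w) → cOf R w = Z ∨ cOf R w = Z' := by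
      intro w hw
      have hw' : |Z.2 * R + 2 - w.2| ≤ 1 ∧ Z.1 * R + R - 2 ≤ w.1 ∧ w.1 ≤ Z.1 * R + R + 1 := by
        rcases hw with ⟨n1, n2⟩ | ⟨n1, n2⟩ <;> simp only [hp, hq] at n1 n2 <;> rw [abs_le] at n1 <;>
          exact ⟨n2, by omega, by omega⟩
      obtain ⟨n1, n2, n3⟩ := hw'
      rw [abs_le] at n1
      by_cases hw1 : w.1 < Z.1 * R + R
      · left; exact (cOf_eq_iff hR).2 ⟨⟨by linarith, hw1⟩, by linarith, by linarith⟩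
      · right; exact (cOf_eq_iff hR).2 ⟨⟨by linarith, by linarith⟩, by rw [← h1]; linarith, by rw [← h1]; linarith⟩
    have memF : ∀ w, (Near p w ∨ Near q w) → cOf R w ∈ 𝔖.F k := fun w hw => by
      rcases near_pq w hw with h | h <;> rw [h]; exacts [hFZ, hFZ']
    have hpc : cOf R p = Z := (cOf_eq_iff hR).2 ⟨⟨by simp only [hp]; linarith, by simp only [hp]; linarith⟩, by simp only [hp]; linarith, by simp only [hp]; linarith⟩
    have hqc : cOf R q = Z' := (cOf_eq_iff hR).2 ⟨⟨by simp only [hq]; linarith, by simp only [hq]; linarith⟩, by simp only [hq, ← h1]; linarith, by simp only [hq, ← h1]; linarith⟩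
    have hpNB : p ∈ (𝔖.blockData k hR).NB := mem_NB_of_forall_near (by rw [hpc]; exact hZ) fun w hw => memF w (Or.inl hw)
    have hqNB : q ∈ (𝔖.blockData k hR).NB := mem_NB_of_forall_near (by rw [hqc]; exact hZ') fun w hw => memF w (Or.inr hw)
    set p₀ : ℤ × ℤ := (Z.1 * R + R - 2, Z.2 * R + 2) with hp₀
    set q₀ : ℤ × ℤ := (Z'.1 * R + 1, Z.2 * R + 2) with hq₀
    have hp₀ins : Inset R Z p₀ := ⟨by simp only [hp₀]; linarith, by simp only [hp₀]; linarith, by simp only [hp₀]; linarith, by simp only [hp₀]; linarith⟩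
    have hq₀ins : Inset R Z' q₀ := ⟨by simp only [hq₀]; linarith, by simp only [hq₀]; linarith, by simp only [hq₀, ← h1]; linarith, by simp only [hq₀, ← h1]; linarith⟩
    refine ⟨p₀, q₀, hp₀ins, hq₀ins, ?_⟩
    refine ((conn_single (mem_NB_of_inset hZ hp₀ins) hpNB (Or.inr ⟨rfl, ?_⟩)).trans
      (conn_single hpNB hqNB (Or.inr ⟨rfl, ?_⟩))).trans (conn_single hqNB (mem_NB_of_inset hZ' hq₀ins) (Or.inr ⟨rfl, ?_⟩))
    · simp only [hp₀, hp]; rw [abs_eq (by norm_num : (0:ℤ) ≤ 1)]; right; ring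
    · simp only [hp, hq, hright]; rw [abs_eq (by norm_num : (0:ℤ) ≤ 1)]; right; ring
    · simp only [hq, hq₀]; rw [abs_eq (by norm_num : (0:ℤ) ≤ 1)]; right; ring

/-- **The inner fine blocks are 4-connected.** [folklore] -/
theorem blockData_NB_conn : ∀ a ∈ (𝔖.blockData k hR).NB, ∀ b ∈ (𝔖.blockData k hR).NB,
    ReflTransGen (fun x y => x ∈ (𝔖.blockData k hR).NB ∧ y ∈ (𝔖.blockData k hR).NB ∧ OneStep x y) a b := by
  have hR3 : 3 ≤ R := by omega
  have hR0 : 0 < R := by omega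
  -- canonical insets along a coarse chain in the window
  have chain : ∀ {Z Z'}, Conn ↑(𝔖.window k) Z Z' → Z ∈ 𝔖.window k →
      Conn ↑((𝔖.blockData k hR).NB) (Z.1 * R + 1, Z.2 * R + 1) (Z'.1 * R + 1, Z'.2 * R + 1) := by
    intro Z Z' h hZ
    unfold Conn at h
    induction h with
    | refl => exact conn_refl
    | @tail V W _ hVW ih =>
      obtain ⟨hV, hW, hstep⟩ := hVW
      obtain ⟨v, w, hv, hw, hc⟩ := conn_insets_of_oneStep hR4 hV hW hstep
      exact ((ih.trans (conn_inset hV (inset_canonical hR3 V) hv)).trans hc).trans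
        (conn_inset hW hw (inset_canonical hR3 W))
  intro a ha b hb
  obtain ⟨a₀, ha₀, haa₀⟩ := exists_inset_conn_of_mem_NB hR4 ha
  obtain ⟨b₀, hb₀, hbb₀⟩ := exists_inset_conn_of_mem_NB hR4 hb
  have hA := cOf_mem_window_of_mem_NB ha
  have hB := cOf_mem_window_of_mem_NB hb
  have h := (((haa₀.trans (conn_inset hA ha₀ (inset_canonical hR3 _))).trans
    (chain (window_conn _ hA _ hB) hA)).trans (conn_inset hB (inset_canonical hR3 _) hb₀)).trans hbb₀.symm
  exact h

/-- **Every excised fine block is joined through excised fine blocks to one next to an inner fine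
block** (the middle of the side shared by the strip and the core). [folklore] -/
theorem blockData_SQ_inner : ∀ q ∈ (𝔖.blockData k hR).SQB, ∃ q' z,
    ReflTransGen (fun x y => x ∈ (𝔖.blockData k hR).SQB ∧ y ∈ (𝔖.blockData k hR).SQB ∧ OneStep x y) q q' ∧
      OneStep q' z ∧ z ∈ (𝔖.blockData k hR).NB := by
  have hR : 0 < R := by omega
  intro q hq
  obtain ⟨c, hc, hqc⟩ := mem_sqBlocks_iff.1 (mem_SQB_iff.1 hq)
  obtain ⟨hcadj, -⟩ := mem_sqC_iff.1 hc
  obtain ⟨S₀, hS₀, X, hX, hSX⟩ := mem_adjC_iff.1 hcadj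
  have hS₀w : S₀ ∈ 𝔖.window k := S_subset_window hS₀
  have hXF : X ∈ 𝔖.F k := (mem_F_iff').2 (Or.inr ⟨c, hc, hX⟩)
  have hS₀F : S₀ ∈ 𝔖.F k := (mem_F_iff').2 (Or.inl hS₀w)
  -- the middle fine blocks of the shared side: `z` in `S₀` (inner), `q'` in `X` (excised)
  obtain ⟨z, q', hzc, hq'c, hzq', hznear⟩ : ∃ z q' : ℤ × ℤ, cOf R z = S₀ ∧ cOf R q' = X ∧ OneStep q' z ∧
      ∀ w, Near z w → cOf R w = S₀ ∨ cOf R w = X := by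
    rcases hSX with ⟨h1, h2⟩ | ⟨h1, h2⟩
    · rcases (show X.2 = S₀.2 + 1 ∨ X.2 = S₀.2 - 1 by
          rcases abs_eq (by norm_num : (0:ℤ) ≤ 1) |>.1 h2 with h | h <;> omega) with h3 | h3
      · refine ⟨(S₀.1 * R + 2, S₀.2 * R + (R - 1)), (X.1 * R + 2, X.2 * R + 0),
          cOf_mk hR S₀ (by norm_num) (by omega) (by omega) (by omega), cOf_mk hR X (by norm_num) (by omega) le_rfl hR,
          Or.inl ⟨by simp [h1], by simp only [h3]; rw [abs_eq (by norm_num : (0:ℤ) ≤ 1)]; left; ring⟩, fun w ⟨n1, n2⟩ => ?_⟩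
        rw [abs_le] at n1 n2; simp only at n1 n2
        by_cases hw : w.2 < S₀.2 * R + R
        · left; exact (cOf_eq_iff hR).2 ⟨⟨by linarith, by linarith⟩, by linarith, hw⟩
        · right; exact (cOf_eq_iff hR).2 ⟨⟨by rw [← h1]; linarith, by rw [← h1]; linarith⟩, by rw [h3]; linarith, by rw [h3]; linarith⟩
      · refine ⟨(S₀.1 * R + 2, S₀.2 * R + 0), (X.1 * R + 2, X.2 * R + (R - 1)),
          cOf_mk hR S₀ (by norm_num) (by omega) le_rfl hR, cOf_mk hR X (by norm_num) (by omega) (by omega) (by omega),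
          Or.inl ⟨by simp [h1], by simp only [h3]; rw [abs_eq (by norm_num : (0:ℤ) ≤ 1)]; right; ring⟩, fun w ⟨n1, n2⟩ => ?_⟩
        rw [abs_le] at n1 n2; simp only at n1 n2
        by_cases hw : S₀.2 * R ≤ w.2
        · left; exact (cOf_eq_iff hR).2 ⟨⟨by linarith, by linarith⟩, hw, by linarith⟩
        · right; exact (cOf_eq_iff hR).2 ⟨⟨by rw [← h1]; linarith, by rw [← h1]; linarith⟩, by rw [h3]; linarith, by rw [h3]; linarith⟩
    · rcases (show X.1 = S₀.1 + 1 ∨ X.1 = S₀.1 - 1 by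
          rcases abs_eq (by norm_num : (0:ℤ) ≤ 1) |>.1 h2 with h | h <;> omega) with h3 | h3
      · refine ⟨(S₀.1 * R + (R - 1), S₀.2 * R + 2), (X.1 * R + 0, X.2 * R + 2),
          cOf_mk hR S₀ (by omega) (by omega) (by norm_num) (by omega), cOf_mk hR X le_rfl hR (by norm_num) (by omega),
          Or.inr ⟨by simp [h1], by simp only [h3]; rw [abs_eq (by norm_num : (0:ℤ) ≤ 1)]; left; ring⟩, fun w ⟨n1, n2⟩ => ?_⟩
        rw [abs_le] at n1 n2; simp only at n1 n2
        by_cases hw : w.1 < S₀.1 * R + R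
        · left; exact (cOf_eq_iff hR).2 ⟨⟨by linarith, hw⟩, by linarith, by linarith⟩
        · right; exact (cOf_eq_iff hR).2 ⟨⟨by rw [h3]; linarith, by rw [h3]; linarith⟩, by rw [← h1]; linarith, by rw [← h1]; linarith⟩
      · refine ⟨(S₀.1 * R + 0, S₀.2 * R + 2), (X.1 * R + (R - 1), X.2 * R + 2),
          cOf_mk hR S₀ le_rfl hR (by norm_num) (by omega), cOf_mk hR X (by omega) (by omega) (by norm_num) (by omega),
          Or.inr ⟨by simp [h1], by simp only [h3]; rw [abs_eq (by norm_num : (0:ℤ) ≤ 1)]; right; ring⟩, fun w ⟨n1, n2⟩ => ?_⟩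
        rw [abs_le] at n1 n2; simp only at n1 n2
        by_cases hw : S₀.1 * R ≤ w.1
        · left; exact (cOf_eq_iff hR).2 ⟨⟨hw, by linarith⟩, by linarith, by linarith⟩
        · right; exact (cOf_eq_iff hR).2 ⟨⟨by rw [h3]; linarith, by rw [h3]; linarith⟩, by rw [← h1]; linarith, by rw [← h1]; linarith⟩
  have hzNB : z ∈ (𝔖.blockData k hR).NB := mem_NB_of_forall_near (by rw [hzc]; exact hS₀w) fun w hw => by
    rcases hznear w hw with h | h <;> rw [h]; exacts [hS₀F, hXF]
  -- chain inside the core from `q` to `q'`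
  have hC : ∀ W ∈ 𝔖.C c, W ∈ 𝔖.sqBlocks k := fun W hW => mem_sqBlocks_iff.2 ⟨c, hc, hW⟩
  have h1 := conn_fine_of_conn hR (A := (↑(𝔖.C c) : Set (ℤ × ℤ))) (𝔖.C_conn c _ hqc X hX) rfl hq'c hqc
  exact ⟨q', z, reflTransGen_of_imp (fun x y ⟨hx, hy, hxy⟩ => ⟨mem_SQB_iff.2 (hC _ hx), mem_SQB_iff.2 (hC _ hy), hxy⟩) h1,
    hzq', hzNB⟩

end Inner

end FineBlocks.StripData

end Literature.Probability.Percolation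

end
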